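import Mathlib.GroupTheory.SpecificGroups.Quaternion
import Mathlib.Tactic.Linarith
import Mathlib.Tactic.Ring
import Mathlib.Tactic.Positivity
import Mathlib.Tactic.Zify
import Literature.Combinatorics.Additive.TripleProductProperty
import Summits.MatrixMultiplication.OmegaCensus.DihedralLikeTiling
import Summits.MatrixMultiplication.OmegaCensus.DicyclicShiftedTriangles
import Summits.MatrixMultiplication.OmegaCensus.DicyclicOddCharacters
import Summits.MatrixMultiplication.OmegaCensus.DicyclicAvecModTwo
import Summits.MatrixMultiplication.OmegaCensus.DicyclicLift
import HarnessLib

/-!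
# The dicyclic law for `n ≡ 1 (mod 3)`: `β(Q_{4n}) = 8⌊2n/3⌋`

ω-census, family (b3).  Framing: lottery ticket; floor = certified bounds/negative ranges.

**Theorem (`tpp_volume_le_law_dicyclicLike`).** Let `G` have a dihedral-like presentation `ρ, τ : A → G` over the
finite abelian group `A` with `2c₀ = 0 ≠ c₀` (generalized dicyclic groups; `Q_{4n}` for `A = ZMod 2n`, `c₀ = n`),
`|A| ≡ 2 (mod 3)`, `|A| ≥ 14`.  Then every TPP triple has `3|S||T||U| ≤ 8|A| − 16`, i.e. `|S||T||U| ≤ 8⌊|A|/3⌋`.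
For `Q_{4n}`, `n ≡ 1 (mod 3)`, `n ≥ 7`, this is `β(Q_{4n}) ≤ 8⌊2n/3⌋` (`tpp_volume_le_law_quaternion_mod_one`), and with
the lifted dihedral triples (`quaternion_volume_ge_law`) and `dicyclic_law` (`n ≢ 1`):
**`β(Q_{4n}) = 8⌊2n/3⌋ = 2 β(D_{2n})` for every `n ≥ 3`, `n ≠ 4`** (`dicyclic_law_complete`).  The generalized
dihedral groups of the same order `Dih(ZMod 2n) = D_{4n}` have the larger value `4⌊4n/3⌋ = 8⌊2n/3⌋ + 4` for these `n`.

**Proof.** By `avec_mod_two` a volume `> 8⌊|A|/3⌋` forces all six coset parts non-empty and the triangle sums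
`A₁, A₂ ∈ {|A|−2, |A|−1, |A|}` with `A₁ + A₂ ≥ 2|A| − 2`.  The `c₀`-saturated triangles (`sat_counting'`) make every
part of a triangle with sum `|A|` periodic and all but one part of a triangle with sum `|A| − 1` periodic, the last
one punctured-periodic; `near_tiling_contradiction` (odd characters) and `three_dvd_of_double_tiling'` exclude
`A₁, A₂ ∈ {|A|−1, |A|}`, and the parity lemma `no_edge_class` excludes the edges `(|A|, |A|−2)`, `(|A|−2, |A|)`.
-/

namespace Summit.MatrixMultiplication.OmegaCensus

open Literature.Combinatorics.Additive Finset

/-- The A-level classification transported to the six part sizes (`avec_mod_two` applied to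
`A₀ = s₀t₀u₀, A₁ = Σ tri₁, A₂ = Σ tri₂, A₃ = s₁t₁u₁`, Newton's inequalities coming from the factorisations).
[folklore] -/
theorem parts_mod_two (N s₀ s₁ t₀ t₁ u₀ u₁ : ℕ) (hmod : N % 3 = 2) (heven : N % 2 = 0) (hN : 14 ≤ N)
    (h₀ : s₀ * t₀ * u₀ ≤ N) (h₃ : s₁ * t₁ * u₁ ≤ N)
    (h₁ : s₁ * t₀ * u₀ + s₀ * t₁ * u₀ + s₀ * t₀ * u₁ ≤ N)
    (h₂ : s₀ * t₁ * u₁ + s₁ * t₀ * u₁ + s₁ * t₁ * u₀ ≤ N)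
    (hV : 8 * N < 3 * ((s₀ + s₁) * (t₀ + t₁) * (u₀ + u₁)) + 16) :
    1 ≤ s₀ * t₀ * u₀ ∧ 1 ≤ s₁ * t₁ * u₁ ∧
    N ≤ s₁ * t₀ * u₀ + s₀ * t₁ * u₀ + s₀ * t₀ * u₁ + 2 ∧
    N ≤ s₀ * t₁ * u₁ + s₁ * t₀ * u₁ + s₁ * t₁ * u₀ + 2 ∧
    2 * N ≤ (s₁ * t₀ * u₀ + s₀ * t₁ * u₀ + s₀ * t₀ * u₁) + (s₀ * t₁ * u₁ + s₁ * t₀ * u₁ + s₁ * t₁ * u₀) + 2 ∧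
    (s₀ * t₁ * u₁ + s₁ * t₀ * u₁ + s₁ * t₁ * u₀ + 2 = N →
      (3 * (s₀ * t₀ * u₀) + 2 = N ∧ 3 * (s₁ * t₁ * u₁) + 5 = N) ∨
      (3 * (s₀ * t₀ * u₀) = N + 1 ∧ (3 * (s₁ * t₁ * u₁) + 8 = N ∨ 3 * (s₁ * t₁ * u₁) + 5 = N))) ∧
    (s₁ * t₀ * u₀ + s₀ * t₁ * u₀ + s₀ * t₀ * u₁ + 2 = N →
      (3 * (s₁ * t₁ * u₁) + 2 = N ∧ 3 * (s₀ * t₀ * u₀) + 5 = N) ∨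
      (3 * (s₁ * t₁ * u₁) = N + 1 ∧ (3 * (s₀ * t₀ * u₀) + 8 = N ∨ 3 * (s₀ * t₀ * u₀) + 5 = N))) := by
  set A₀ : ℤ := (s₀ : ℤ) * t₀ * u₀ with hA₀
  set A₃ : ℤ := (s₁ : ℤ) * t₁ * u₁ with hA₃
  set X : ℤ := (s₁ : ℤ) * t₀ * u₀ with hX
  set Y : ℤ := (s₀ : ℤ) * t₁ * u₀ with hY
  set Z : ℤ := (s₀ : ℤ) * t₀ * u₁ with hZ
  set X' : ℤ := (s₀ : ℤ) * t₁ * u₁ with hX'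
  set Y' : ℤ := (s₁ : ℤ) * t₀ * u₁ with hY'
  set Z' : ℤ := (s₁ : ℤ) * t₁ * u₀ with hZ'
  have q₀ : A₀ ≤ N := by rw [hA₀]; exact_mod_cast h₀
  have q₃ : A₃ ≤ N := by rw [hA₃]; exact_mod_cast h₃
  have q₁ : X + Y + Z ≤ N := by rw [hX, hY, hZ]; exact_mod_cast h₁
  have q₂ : X' + Y' + Z' ≤ N := by rw [hX', hY', hZ']; exact_mod_cast h₂
  have e₁ : A₀ * (X' + Y' + Z') = X * Y + Y * Z + Z * X := by
    simp only [hA₀, hX, hY, hZ, hX', hY', hZ']; ring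
  have e₂ : (X + Y + Z) * A₃ = X' * Y' + Y' * Z' + Z' * X' := by
    simp only [hA₃, hX, hY, hZ, hX', hY', hZ']; ring
  have hN₁ : 3 * A₀ * (X' + Y' + Z') ≤ (X + Y + Z) ^ 2 := by
    linarith [e₁, sq_nonneg (X - Y), sq_nonneg (Y - Z), sq_nonneg (Z - X)]
  have hN₂ : 3 * (X + Y + Z) * A₃ ≤ (X' + Y' + Z') ^ 2 := by
    linarith [e₂, sq_nonneg (X' - Y'), sq_nonneg (Y' - Z'), sq_nonneg (Z' - X')]
  have eV : ((s₀ : ℤ) + s₁) * (t₀ + t₁) * (u₀ + u₁) = A₀ + (X + Y + Z) + (X' + Y' + Z') + A₃ := by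
    simp only [hA₀, hA₃, hX, hY, hZ, hX', hY', hZ']; ring
  have hlt : 8 * (N : ℤ) < 3 * (((s₀ : ℤ) + s₁) * (t₀ + t₁) * (u₀ + u₁)) + 16 := by exact_mod_cast hV
  have hV' : 8 * (N : ℤ) - 15 ≤ 3 * (A₀ + (X + Y + Z) + (X' + Y' + Z') + A₃) := by linarith
  obtain ⟨hA0, hA3, hA1, hA2, hsum, hedge2, hedge1⟩ := avec_mod_two N A₀ (X + Y + Z) (X' + Y' + Z') A₃
    (by positivity) (by positivity) (by positivity) (by positivity) q₀ q₁ q₂ q₃ hN₁ hN₂ (by omega) (by omega)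
    (by omega) hV'
  refine ⟨by zify; linarith, by zify; linarith, by zify; linarith, by zify; linarith, by zify; linarith,
    fun h => ?_, fun h => ?_⟩
  · have h' : X' + Y' + Z' = (N : ℤ) - 2 := by zify at h; linarith
    rcases hedge2 h' with ⟨k0, k3⟩ | ⟨k0, k3 | k3⟩
    · exact Or.inl ⟨by zify; linarith, by zify; linarith⟩
    · exact Or.inr ⟨by zify; linarith, Or.inl (by zify; linarith)⟩
    · exact Or.inr ⟨by zify; linarith, Or.inr (by zify; linarith)⟩
  · have h' : X + Y + Z = (N : ℤ) - 2 := by zify at h; linarith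
    rcases hedge1 h' with ⟨k3, k0⟩ | ⟨k3, k0 | k0⟩
    · exact Or.inl ⟨by zify; linarith, by zify; linarith⟩
    · exact Or.inr ⟨by zify; linarith, Or.inl (by zify; linarith)⟩
    · exact Or.inr ⟨by zify; linarith, Or.inr (by zify; linarith)⟩

section DihedralLike

variable {A : Type*} [AddCommGroup A] [DecidableEq A] [Fintype A] {G : Type} [Group G] [DecidableEq G]
  {ρ τ : A → G} {c₀ : A} {S T U : Finset G}

omit [Fintype A] in
/-- A triangle whose parts have total size `≥ N` while its saturations have total size `≤ N` consists of
periodic parts. [folklore] -/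
theorem triangle_periodic {P Q R : Finset A} {N : ℕ}
    (hsat : (P ∪ P.image fun x => x + c₀).card + (Q ∪ Q.image fun x => x + c₀).card +
      (R ∪ R.image fun x => x + c₀).card ≤ N) (hsum : N ≤ P.card + Q.card + R.card) :
    P.image (fun x => x + c₀) = P ∧ Q.image (fun x => x + c₀) = Q ∧ R.image (fun x => x + c₀) = R := by
  have hP := card_le_card_sat (c₀ := c₀) P
  have hQ := card_le_card_sat (c₀ := c₀) Q
  have hR := card_le_card_sat (c₀ := c₀) R
  exact ⟨periodic_of_card_sat_eq (by omega), periodic_of_card_sat_eq (by omega),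
    periodic_of_card_sat_eq (by omega)⟩

omit [Fintype A] in
/-- Structure of a triangle from its saturation count: with saturations of total size `≤ N` and parts of total size
`≥ N − 1`, either all three parts are periodic, or exactly one is punctured-periodic and the other two are periodic
(`2c₀ = 0`). [folklore] -/
theorem triangle_structure (h2 : c₀ + c₀ = 0) {P Q R : Finset A} {N : ℕ}
    (hsat : (P ∪ P.image fun x => x + c₀).card + (Q ∪ Q.image fun x => x + c₀).card +
      (R ∪ R.image fun x => x + c₀).card ≤ N) (hsum : N ≤ P.card + Q.card + R.card + 1) :
    (P.image (fun x => x + c₀) = P ∧ Q.image (fun x => x + c₀) = Q ∧ R.image (fun x => x + c₀) = R) ∨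
    ((∃ d, d ∉ P ∧ (insert d P).image (fun x => x + c₀) = insert d P) ∧
        Q.image (fun x => x + c₀) = Q ∧ R.image (fun x => x + c₀) = R) ∨
    (P.image (fun x => x + c₀) = P ∧ (∃ d, d ∉ Q ∧ (insert d Q).image (fun x => x + c₀) = insert d Q) ∧
        R.image (fun x => x + c₀) = R) ∨
    (P.image (fun x => x + c₀) = P ∧ Q.image (fun x => x + c₀) = Q ∧
        ∃ d, d ∉ R ∧ (insert d R).image (fun x => x + c₀) = insert d R) := by
  have hP := card_le_card_sat (c₀ := c₀) P
  have hQ := card_le_card_sat (c₀ := c₀) Q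
  have hR := card_le_card_sat (c₀ := c₀) R
  have near : ∀ X : Finset A, (X ∪ X.image fun x => x + c₀).card = X.card + 1 →
      ∃ d, d ∉ X ∧ (insert d X).image (fun x => x + c₀) = insert d X := by
    intro X hX
    obtain ⟨d, hd, hEq⟩ := exists_insert_of_card_sat hX
    refine ⟨d, hd, ?_⟩
    rw [← hEq]
    exact image_shift_sat h2 X
  by_cases eP : (P ∪ P.image fun x => x + c₀).card = P.card
  · by_cases eQ : (Q ∪ Q.image fun x => x + c₀).card = Q.card
    · by_cases eR : (R ∪ R.image fun x => x + c₀).card = R.card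
      · exact Or.inl ⟨periodic_of_card_sat_eq eP, periodic_of_card_sat_eq eQ, periodic_of_card_sat_eq eR⟩
      · exact Or.inr (Or.inr (Or.inr ⟨periodic_of_card_sat_eq eP, periodic_of_card_sat_eq eQ,
          near R (by omega)⟩))
    · exact Or.inr (Or.inr (Or.inl ⟨periodic_of_card_sat_eq eP, near Q (by omega),
        periodic_of_card_sat_eq (X := R) (by omega)⟩))
  · exact Or.inr (Or.inl ⟨near P (by omega), periodic_of_card_sat_eq (X := Q) (by omega),
      periodic_of_card_sat_eq (X := R) (by omega)⟩)

/-- **Abstract core.** Six non-empty sets with all eight sumsets injective, saturated triangles of total size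
`≤ N = |A|` (`N` even, `2c₀ = 0 ≠ c₀`), triangle sums in `[N−1, N]` and not both `N`: contradiction
(`triangle_structure` + `near_tiling_contradiction`). [folklore] -/
theorem near_extremal_contradiction (h2 : c₀ + c₀ = 0) (hc : c₀ ≠ 0) {S₀ S₁ T₀ T₁ U₀ U₁ : Finset A}
    (hS₀ : S₀.Nonempty) (hS₁ : S₁.Nonempty) (hT₀ : T₀.Nonempty) (hT₁ : T₁.Nonempty)
    (hU₀ : U₀.Nonempty) (hU₁ : U₁.Nonempty)
    (i000 : Set.InjOn (fun p : A × A × A => p.1 + p.2.1 + p.2.2) ↑(S₀ ×ˢ T₀ ×ˢ U₀))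
    (i001 : Set.InjOn (fun p : A × A × A => p.1 + p.2.1 + p.2.2) ↑(S₀ ×ˢ T₀ ×ˢ U₁))
    (i010 : Set.InjOn (fun p : A × A × A => p.1 + p.2.1 + p.2.2) ↑(S₀ ×ˢ T₁ ×ˢ U₀))
    (i011 : Set.InjOn (fun p : A × A × A => p.1 + p.2.1 + p.2.2) ↑(S₀ ×ˢ T₁ ×ˢ U₁))
    (i100 : Set.InjOn (fun p : A × A × A => p.1 + p.2.1 + p.2.2) ↑(S₁ ×ˢ T₀ ×ˢ U₀))
    (i101 : Set.InjOn (fun p : A × A × A => p.1 + p.2.1 + p.2.2) ↑(S₁ ×ˢ T₀ ×ˢ U₁))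
    (i110 : Set.InjOn (fun p : A × A × A => p.1 + p.2.1 + p.2.2) ↑(S₁ ×ˢ T₁ ×ˢ U₀))
    (i111 : Set.InjOn (fun p : A × A × A => p.1 + p.2.1 + p.2.2) ↑(S₁ ×ˢ T₁ ×ˢ U₁))
    (sat1 : (((S₁ ×ˢ T₀ ×ˢ U₀).image fun p : A × A × A => p.1 + p.2.1 + p.2.2) ∪
        ((S₁ ×ˢ T₀ ×ˢ U₀).image fun p : A × A × A => p.1 + p.2.1 + p.2.2).image fun x => x + c₀).card +
      (((S₀ ×ˢ T₁ ×ˢ U₀).image fun p : A × A × A => p.1 + p.2.1 + p.2.2) ∪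
        ((S₀ ×ˢ T₁ ×ˢ U₀).image fun p : A × A × A => p.1 + p.2.1 + p.2.2).image fun x => x + c₀).card +
      (((S₀ ×ˢ T₀ ×ˢ U₁).image fun p : A × A × A => p.1 + p.2.1 + p.2.2) ∪
        ((S₀ ×ˢ T₀ ×ˢ U₁).image fun p : A × A × A => p.1 + p.2.1 + p.2.2).image fun x => x + c₀).card ≤ Fintype.card A)
    (sat2 : (((S₀ ×ˢ T₁ ×ˢ U₁).image fun p : A × A × A => p.1 + p.2.1 + p.2.2) ∪
        ((S₀ ×ˢ T₁ ×ˢ U₁).image fun p : A × A × A => p.1 + p.2.1 + p.2.2).image fun x => x + c₀).card +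
      (((S₁ ×ˢ T₀ ×ˢ U₁).image fun p : A × A × A => p.1 + p.2.1 + p.2.2) ∪
        ((S₁ ×ˢ T₀ ×ˢ U₁).image fun p : A × A × A => p.1 + p.2.1 + p.2.2).image fun x => x + c₀).card +
      (((S₁ ×ˢ T₁ ×ˢ U₀).image fun p : A × A × A => p.1 + p.2.1 + p.2.2) ∪
        ((S₁ ×ˢ T₁ ×ˢ U₀).image fun p : A × A × A => p.1 + p.2.1 + p.2.2).image fun x => x + c₀).card ≤ Fintype.card A)
    (heven : Fintype.card A % 2 = 0)
    (hA₁ : Fintype.card A ≤ S₁.card * T₀.card * U₀.card + S₀.card * T₁.card * U₀.card + S₀.card * T₀.card * U₁.card + 1)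
    (hA₁' : S₁.card * T₀.card * U₀.card + S₀.card * T₁.card * U₀.card + S₀.card * T₀.card * U₁.card ≤ Fintype.card A)
    (hA₂ : Fintype.card A ≤ S₀.card * T₁.card * U₁.card + S₁.card * T₀.card * U₁.card + S₁.card * T₁.card * U₀.card + 1)
    (hA₂' : S₀.card * T₁.card * U₁.card + S₁.card * T₀.card * U₁.card + S₁.card * T₁.card * U₀.card ≤ Fintype.card A)
    (hboth : ¬ (S₁.card * T₀.card * U₀.card + S₀.card * T₁.card * U₀.card + S₀.card * T₀.card * U₁.card =
        Fintype.card A ∧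
      S₀.card * T₁.card * U₁.card + S₁.card * T₀.card * U₁.card + S₁.card * T₁.card * U₀.card = Fintype.card A)) :
    False := by
  have c100 : ((S₁ ×ˢ T₀ ×ˢ U₀).image fun p : A × A × A => p.1 + p.2.1 + p.2.2).card = S₁.card * T₀.card * U₀.card := by
    rw [card_image_of_injOn i100, card_product, card_product, mul_assoc]
  have c010 : ((S₀ ×ˢ T₁ ×ˢ U₀).image fun p : A × A × A => p.1 + p.2.1 + p.2.2).card = S₀.card * T₁.card * U₀.card := by
    rw [card_image_of_injOn i010, card_product, card_product, mul_assoc]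
  have c001 : ((S₀ ×ˢ T₀ ×ˢ U₁).image fun p : A × A × A => p.1 + p.2.1 + p.2.2).card = S₀.card * T₀.card * U₁.card := by
    rw [card_image_of_injOn i001, card_product, card_product, mul_assoc]
  have c011 : ((S₀ ×ˢ T₁ ×ˢ U₁).image fun p : A × A × A => p.1 + p.2.1 + p.2.2).card = S₀.card * T₁.card * U₁.card := by
    rw [card_image_of_injOn i011, card_product, card_product, mul_assoc]
  have c101 : ((S₁ ×ˢ T₀ ×ˢ U₁).image fun p : A × A × A => p.1 + p.2.1 + p.2.2).card = S₁.card * T₀.card * U₁.card := by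
    rw [card_image_of_injOn i101, card_product, card_product, mul_assoc]
  have c110 : ((S₁ ×ˢ T₁ ×ˢ U₀).image fun p : A × A × A => p.1 + p.2.1 + p.2.2).card = S₁.card * T₁.card * U₀.card := by
    rw [card_image_of_injOn i110, card_product, card_product, mul_assoc]
  have evenOf : ∀ {P : Finset A} {k : ℕ}, P.image (fun x => x + c₀) = P → P.card = k → k % 2 = 0 := by
    intro P k hP hk
    have := Nat.even_iff.mp (even_card_of_periodic h2 hc P hP)
    rwa [hk] at this
  have h1 := triangle_structure h2 sat1 (by rw [c100, c010, c001]; exact hA₁)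
  have h3 := triangle_structure h2 sat2 (by rw [c011, c101, c110]; exact hA₂)
  refine near_tiling_contradiction h2 hc hS₀ hS₁ hT₀ hT₁ hU₀ hU₁ i000 i001 i010 i011 i100 i101 i110 i111
    h1 h3 fun hall => hboth ?_
  obtain ⟨p100, p010, p001, p011, p101, p110⟩ := hall
  have e1 := evenOf p100 c100
  have e2 := evenOf p010 c010
  have e3 := evenOf p001 c001
  have e4 := evenOf p011 c011
  have e5 := evenOf p101 c101
  have e6 := evenOf p110 c110
  constructor <;> omega

/-- **`3|S||T||U| ≤ 8|A| − 16` for dicyclic-like groups with `|A| ≡ 2 (mod 3)`, `|A| ≥ 14`.** [folklore] -/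
theorem tpp_volume_le_law_dicyclicLike
    (hρρ : ∀ a b, ρ a * ρ b = ρ (a + b)) (hρτ : ∀ a b, ρ a * τ b = τ (b - a))
    (hτρ : ∀ a b, τ a * ρ b = τ (a + b)) (hττ : ∀ a b, τ a * τ b = ρ (c₀ + b - a))
    (hρ : Function.Injective ρ) (hτ : Function.Injective τ) (hne : ∀ a b, ρ a ≠ τ b)
    (hsurj : ∀ g, (∃ a, ρ a = g) ∨ (∃ a, τ a = g)) (h2 : c₀ + c₀ = 0) (hc : c₀ ≠ 0)
    (hmod : Fintype.card A % 3 = 2) (hA : 14 ≤ Fintype.card A) (h : TripleProductProperty S T U) :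
    3 * (S.card * T.card * U.card) + 16 ≤ 8 * Fintype.card A := by
  set S₀ : Finset A := univ.filter fun a => ρ a ∈ S with hS₀
  set S₁ : Finset A := univ.filter fun a => τ a ∈ S with hS₁
  set T₀ : Finset A := univ.filter fun a => ρ a ∈ T with hT₀
  set T₁ : Finset A := univ.filter fun a => τ a ∈ T with hT₁
  set U₀ : Finset A := univ.filter fun a => ρ a ∈ U with hU₀
  set U₁ : Finset A := univ.filter fun a => τ a ∈ U with hU₁
  have mS₀' : ∀ a ∈ S₀, ρ a ∈ S := fun a ha => (mem_filter.1 ha).2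
  have mS₁' : ∀ a ∈ S₁, τ a ∈ S := fun a ha => (mem_filter.1 ha).2
  have mT₀' : ∀ a ∈ T₀, ρ a ∈ T := fun a ha => (mem_filter.1 ha).2
  have mT₁' : ∀ a ∈ T₁, τ a ∈ T := fun a ha => (mem_filter.1 ha).2
  have mU₀' : ∀ a ∈ U₀, ρ a ∈ U := fun a ha => (mem_filter.1 ha).2
  have mU₁' : ∀ a ∈ U₁, τ a ∈ U := fun a ha => (mem_filter.1 ha).2
  have mS₀ : ∀ a ∈ S₀, cond false (τ a) (ρ a) ∈ S := mS₀'
  have mS₁ : ∀ a ∈ S₁, cond true (τ a) (ρ a) ∈ S := mS₁'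
  have mT₀ : ∀ a ∈ T₀, cond false (τ a) (ρ a) ∈ T := mT₀'
  have mT₁ : ∀ a ∈ T₁, cond true (τ a) (ρ a) ∈ T := mT₁'
  have mU₀ : ∀ a ∈ U₀, cond false (τ a) (ρ a) ∈ U := mU₀'
  have mU₁ : ∀ a ∈ U₁, cond true (τ a) (ρ a) ∈ U := mU₁'
  obtain ⟨h₀, h₃, h₁, h₂⟩ := parts_counting' hρρ hρτ hτρ hττ hρ hτ hne h
  -- restate with the abbreviations (syntactic form matters for `omega`)
  replace h₀ : S₀.card * T₀.card * U₀.card ≤ Fintype.card A := h₀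
  replace h₃ : S₁.card * T₁.card * U₁.card ≤ Fintype.card A := h₃
  replace h₁ : S₁.card * T₀.card * U₀.card + S₀.card * T₁.card * U₀.card + S₀.card * T₀.card * U₁.card ≤
      Fintype.card A := h₁
  replace h₂ : S₀.card * T₁.card * U₁.card + S₁.card * T₀.card * U₁.card + S₁.card * T₁.card * U₀.card ≤
      Fintype.card A := h₂
  have inj := sum_injOn' hρρ hττ hρ hτ h
  -- `|A|` is even (the translation by `c₀` is a fixed-point-free involution of `A`)
  have hAeven : Fintype.card A % 2 = 0 := by
    have hu : (univ : Finset A).image (fun x => x + c₀) = univ :=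
      eq_of_subset_of_card_le (subset_univ _) (by rw [card_image_of_injective _ (add_left_injective c₀)])
    have := even_card_of_periodic h2 hc univ hu
    rw [Finset.card_univ] at this
    exact Nat.even_iff.mp this
  rw [card_eq_parts' hρ hτ hne hsurj S, card_eq_parts' hρ hτ hne hsurj T, card_eq_parts' hρ hτ hne hsurj U]
  by_contra hlt
  push Not at hlt
  replace hlt : 8 * Fintype.card A <
      3 * ((S₀.card + S₁.card) * (T₀.card + T₁.card) * (U₀.card + U₁.card)) + 16 := hlt
  obtain ⟨hA0, hA3, hA1, hA2, hsum, hedge2, hedge1⟩ :=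
    parts_mod_two (Fintype.card A) S₀.card S₁.card T₀.card T₁.card U₀.card U₁.card hmod hAeven hA h₀ h₃ h₁ h₂ hlt
  -- non-empty parts
  have pos : ∀ {a b c : Finset A}, 1 ≤ a.card * b.card * c.card → a.Nonempty ∧ b.Nonempty ∧ c.Nonempty := by
    intro a b c habc
    refine ⟨card_pos.1 (Nat.pos_of_ne_zero fun h0 => ?_), card_pos.1 (Nat.pos_of_ne_zero fun h0 => ?_),
      card_pos.1 (Nat.pos_of_ne_zero fun h0 => ?_)⟩ <;> simp [h0] at habc
  obtain ⟨neS₀, neT₀, neU₀⟩ := pos hA0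
  obtain ⟨neS₁, neT₁, neU₁⟩ := pos hA3
  -- saturated triangles and sumset sizes
  obtain ⟨sat1, sat2⟩ := sat_counting' hρρ hρτ hτρ hττ hne h2 h mS₀' mS₁' mT₀' mT₁' mU₀' mU₁'
  have cs := card_sumset' hρρ hττ hρ hτ h
  have evenOf : ∀ {P : Finset A} {k : ℕ}, P.image (fun x => x + c₀) = P → P.card = k → Even k := by
    intro P k hP hk
    rw [← hk]
    exact even_card_of_periodic h2 hc P hP
  -- the two edges `(N-2, N)`, `(N, N-2)`: parity lemma
  by_cases hA1e : S₁.card * T₀.card * U₀.card + S₀.card * T₁.card * U₀.card + S₀.card * T₀.card * U₁.card + 2 =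
      Fintype.card A
  · obtain ⟨p011, p101, p110⟩ := triangle_periodic sat2
      (by rw [cs false true true mS₀ mT₁ mU₁, cs true false true mS₁ mT₀ mU₁, cs true true false mS₁ mT₁ mU₀]; omega)
    exact no_edge_class (Fintype.card A) S₁.card S₀.card T₁.card T₀.card U₁.card U₀.card
      (evenOf p011 (cs false true true mS₀ mT₁ mU₁)) (evenOf p101 (cs true false true mS₁ mT₀ mU₁))
      (evenOf p110 (cs true true false mS₁ mT₁ mU₀)) (by omega) hA1e (hedge1 hA1e)
  by_cases hA2e : S₀.card * T₁.card * U₁.card + S₁.card * T₀.card * U₁.card + S₁.card * T₁.card * U₀.card + 2 =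
      Fintype.card A
  · obtain ⟨p100, p010, p001⟩ := triangle_periodic sat1
      (by rw [cs true false false mS₁ mT₀ mU₀, cs false true false mS₀ mT₁ mU₀, cs false false true mS₀ mT₀ mU₁]; omega)
    exact no_edge_class (Fintype.card A) S₀.card S₁.card T₀.card T₁.card U₀.card U₁.card
      (evenOf p100 (cs true false false mS₁ mT₀ mU₀)) (evenOf p010 (cs false true false mS₀ mT₁ mU₀))
      (evenOf p001 (cs false false true mS₀ mT₀ mU₁)) (by omega) hA2e (hedge2 hA2e)
  -- both triangle sums are `N - 1` or `N`
  by_cases hboth : S₁.card * T₀.card * U₀.card + S₀.card * T₁.card * U₀.card + S₀.card * T₀.card * U₁.card =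
        Fintype.card A ∧
      S₀.card * T₁.card * U₁.card + S₁.card * T₀.card * U₁.card + S₁.card * T₁.card * U₀.card = Fintype.card A
  · have h3 := three_dvd_of_double_tiling' hρρ hρτ hτρ hττ hρ hτ hne h neS₀ neS₁ neT₀ neT₁ neU₀ neU₁ hboth.1 hboth.2
    omega
  exact near_extremal_contradiction h2 hc neS₀ neS₁ neT₀ neT₁ neU₀ neU₁
    (inj false false false mS₀ mT₀ mU₀) (inj false false true mS₀ mT₀ mU₁) (inj false true false mS₀ mT₁ mU₀)
    (inj false true true mS₀ mT₁ mU₁) (inj true false false mS₁ mT₀ mU₀) (inj true false true mS₁ mT₀ mU₁)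
    (inj true true false mS₁ mT₁ mU₀) (inj true true true mS₁ mT₁ mU₁) sat1 sat2 hAeven
    (by omega) h₁ (by omega) h₂ hboth

end DihedralLike

/-! ## The dicyclic groups `Q_{4n}` -/

section Quaternion

variable {n : ℕ} [NeZero n]

/-- **`β(Q_{4n}) ≤ 8⌊2n/3⌋` for `n ≡ 1 (mod 3)`, `n ≥ 7`** (the dihedral-like bound `4⌊4n/3⌋` is `4` larger here).
[folklore] -/
theorem tpp_volume_le_law_quaternion_mod_one {S T U : Finset (QuaternionGroup n)} (hmod : n % 3 = 1)
    (hn : 7 ≤ n) (h : TripleProductProperty S T U) : S.card * T.card * U.card ≤ 8 * (2 * n / 3) := by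
  have h2 : ((n : ℕ) : ZMod (2 * n)) + ((n : ℕ) : ZMod (2 * n)) = 0 := by
    have : ((2 * n : ℕ) : ZMod (2 * n)) = 0 := ZMod.natCast_self _
    push_cast at this ⊢
    linear_combination this
  have hc : ((n : ℕ) : ZMod (2 * n)) ≠ 0 := by
    rw [Ne, ZMod.natCast_eq_zero_iff]
    intro hd
    have := Nat.le_of_dvd (by omega) hd
    omega
  have key := tpp_volume_le_law_dicyclicLike (A := ZMod (2 * n)) (ρ := QuaternionGroup.a)
    (τ := QuaternionGroup.xa) (c₀ := (n : ZMod (2 * n))) QuaternionGroup.a_mul_a QuaternionGroup.a_mul_xa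
    QuaternionGroup.xa_mul_a QuaternionGroup.xa_mul_xa (fun i j hij => by cases hij; rfl)
    (fun i j hij => by cases hij; rfl) (fun i j hij => by cases hij) (fun g => by
      cases g with
      | a i => exact Or.inl ⟨i, rfl⟩
      | xa i => exact Or.inr ⟨i, rfl⟩) h2 hc (by rw [ZMod.card]; omega) (by rw [ZMod.card]; omega) h
  rw [ZMod.card] at key
  omega

/-- **The complete dicyclic law: `β(Q_{4n}) = 8⌊2n/3⌋ = 2 β(D_{2n})` for every `n ≥ 3`, `n ≠ 4`** (upper bound:
`dicyclic_law` for `n ≢ 1 (mod 3)` and `tpp_volume_le_law_quaternion_mod_one` for `n ≡ 1`; attained by the lifted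
dihedral triples, `quaternion_volume_ge_law`).  For `n = 4` the kernel window is `16 ≤ β(Q₁₆) ≤ 20`
(`dicyclic_window`; the census value `β(Q₁₆) = 16` is by exhaustive search). [folklore] -/
theorem dicyclic_law_complete (hn : 3 ≤ n) (h4 : n ≠ 4) :
    (∀ S T U : Finset (QuaternionGroup n), TripleProductProperty S T U →
        S.card * T.card * U.card ≤ 8 * (2 * n / 3)) ∧
    ∃ S T U : Finset (QuaternionGroup n), TripleProductProperty S T U ∧ S.card * T.card * U.card = 8 * (2 * n / 3) := by
  by_cases hmod : n % 3 = 1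
  · exact ⟨fun S T U h => tpp_volume_le_law_quaternion_mod_one hmod (by omega) h, quaternion_volume_ge_law hn⟩
  · exact dicyclic_law hn hmod

omit [NeZero n] in
/-- For `n ≡ 1 (mod 3)`, `n ≥ 7`, the dicyclic group `Q_{4n}` has strictly smaller TPP capacity than the dihedral
group `D_{4n}` of the same order: `β(Q_{4n}) = 8⌊2n/3⌋ < 4⌊2(2n)/3⌋ = β(D_{4n})` (`dihedral_law` at `2n`); for
`n ≢ 1 (mod 3)` the two laws coincide. [folklore] -/
theorem dicyclic_law_lt_dihedral_law (hmod : n % 3 = 1) : 8 * (2 * n / 3) + 4 = 4 * (2 * (2 * n) / 3) := by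
  omega

end Quaternion

end Summit.MatrixMultiplication.OmegaCensus
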